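import Summits.ResolutionOfSingularities.ResolutionOfSingularities.Theorems.WeightedInvariantLocalWeightedDropTrackCDefs
import Summits.ResolutionOfSingularities.ResolutionOfSingularities.Theorems.WeightedInvariantLocalWeightedDropTrackCMonomialDivisor
import Summits.ResolutionOfSingularities.ResolutionOfSingularities.Theorems.WeightedInvariantWeightedConstructionFormalChartCohen
import Summits.ResolutionOfSingularities.ResolutionOfSingularities.Theorems.WeightedInvariantGlobalizeLocalDropCanonize
import Literature.AlgebraicGeometry.Resolution.AdicCompletionRegular
import Literature.AlgebraicGeometry.Resolution.AlterationsSingularComponents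
import Literature.AlgebraicGeometry.Resolution.PowerSeriesRegularLocal
import Literature.RingTheory.MvPowerSeries.MaximalIdealPow

/-!
# Track C: Cohen frames — regularity, dimension, residue field, change of frame, adapted frames

[OURS · L1 W4.3 · chain w43, stub worker 4] Helper for TRACK C of the engine crux `LocalWeightedDrop`
(stmt-ResolutionOfSingularities-8899; skeleton `L/res-L1-w43-stub-4/TrackC_Skeleton.lean`; definitions
`Theorems/…TrackCDefs.lean`). NOT a statement of any manuscript.

For a framed point `(z, F)` of a `Z₀`-scheme (`F.e : 𝒪̂_{Z,z} ≃ k⟦X₀,X₁,X₂⟧`, constants to constants):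
* `Frame.approx` — series of order `≥ N` come from `𝔪̂ᴺ`; `Frame.isRegularLocalRing`, `Frame.ringKrullDim_eq`
  (`𝒪_{Z,z}` is regular local of dimension `3`), `Frame.residue_surjective` (its residue field is `k`);
* `Frame.exists_subst` — **change of frame**: two frames at the same point differ by a formal coordinate change
  `subst φ` (`φ(0) = 0`, invertible linear part) — Cohen coordinates are unique up to the game's coordinate
  changes (`ringEquiv_map_eq_subst`);
* `Frame.exists_adapted` — **adapted frames**: any regular system of parameters `y : Fin 3 → 𝒪_{Z,z}` is the
  coordinate system of some frame (`stub_formalChart_cohen`);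
* `Frame.won_of_dvd_of_eq_unit_mul_monomial` — if in SOME frame the total transform is a unit times a monomial,
  then every divisor of the total transform in ANY frame is won (`won_of_dvd_unit_mul_monomial` +
  `won_subst_iff`).
-/

noncomputable section

open CategoryTheory AlgebraicGeometry TopologicalSpace IsLocalRing
open Literature.AlgebraicGeometry.Resolution
open Literature.RingTheory.MvPowerSeries.Jets

set_option linter.dupNamespace false -- mandated namespace of this single-conjunct summit

namespace Summit.ResolutionOfSingularities.ResolutionOfSingularities.Theorems.TrackC

variable {k : Type} [Field k]

namespace Frame

variable {Z : Scheme.{0}} {σ : Z ⟶ Spec (.of (MvPowerSeries (Fin 3) k))} {z : Z}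
  [hN : IsNoetherianRing (Z.presheaf.stalk z)]

/-- Series without terms of degree `< N` come from `𝔪̂ᴺ` under a frame. [OURS · folklore] -/
theorem approx (F : Frame σ z) (N : ℕ) (G : MvPowerSeries (Fin 3) k)
    (hG : ∀ x : Fin 3 →₀ ℕ, x.degree < N → MvPowerSeries.coeff x G = 0) :
    F.e.symm G ∈ maximalIdeal (AdicCompletion (maximalIdeal (Z.presheaf.stalk z)) (Z.presheaf.stalk z)) ^ N := by
  have h1 : G ∈ maximalIdeal (MvPowerSeries (Fin 3) k) ^ N := mem_maximalIdeal_pow_of_coeff_eq_zero hG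
  have h2 : (maximalIdeal (MvPowerSeries (Fin 3) k)).map F.e.symm.toRingHom =
      maximalIdeal (AdicCompletion (maximalIdeal (Z.presheaf.stalk z)) (Z.presheaf.stalk z)) :=
    map_ringEquiv_maximalIdeal F.e.symm
  rw [← h2, ← Ideal.map_pow]
  exact Ideal.mem_map_of_mem _ h1

/-- The local ring at a framed point is regular. [OURS · folklore] -/
theorem isRegularLocalRing (F : Frame σ z) : IsRegularLocalRing (Z.presheaf.stalk z) := by
  haveI := isRegularLocalRing_mvPowerSeries k (Fin 3)
  exact isRegularLocalRing_of_adicCompletion_equiv rfl F.e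

/-- The local ring at a framed point has dimension `3`. [OURS · folklore] -/
theorem ringKrullDim_eq (F : Frame σ z) : ringKrullDim (Z.presheaf.stalk z) = (3 : ℕ) := by
  rw [← ringKrullDim_adicCompletion, ringKrullDim_eq_of_ringEquiv F.e, ringKrullDim_mvPowerSeries]
  simp

/-- The residue field at a framed point is `k` (through the constants). [OURS · folklore] -/
theorem residue_surjective (F : Frame σ z) :
    Function.Surjective ((residue (Z.presheaf.stalk z)).comp (stalkConst σ z)) := by
  intro x
  obtain ⟨a, rfl⟩ := Ideal.Quotient.mk_surjective x
  -- the constant term of `a` in the frame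
  set c : k := MvPowerSeries.constantCoeff (F.e (algebraMap _ _ a)) with hc
  refine ⟨c, ?_⟩
  rw [RingHom.comp_apply]
  change residue _ (stalkConst σ z c) = residue _ a
  rw [← sub_eq_zero, ← map_sub, residue_eq_zero_iff]
  -- `const c - a ∈ 𝔪`: its image in the completion lies in `𝔪̂`
  have hmem : algebraMap _ (AdicCompletion (maximalIdeal (Z.presheaf.stalk z)) (Z.presheaf.stalk z))
      (stalkConst σ z c - a) ∈ maximalIdeal _ := by
    have h1 : F.e (algebraMap _ _ (stalkConst σ z c - a)) ∈ maximalIdeal (MvPowerSeries (Fin 3) k) := by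
      rw [mem_maximalIdeal_iff_constantCoeff_eq_zero, map_sub, map_sub, F.map_const, map_sub,
        MvPowerSeries.constantCoeff_C, hc, sub_self]
    have h2 := Ideal.mem_map_of_mem F.e.symm h1
    rw [map_ringEquiv_maximalIdeal F.e.symm, RingEquiv.symm_apply_apply] at h2
    exact h2
  rw [IsLocalRing.mem_maximalIdeal] at hmem ⊢
  exact (map_mem_nonunits_iff _ _).mp hmem

/-- In any frame, the image of a variable of another frame has no constant term. [OURS · folklore] -/
theorem constantCoeff_change (F₁ F₂ : Frame σ z) (i : Fin 3) :
    MvPowerSeries.constantCoeff (F₂.e (F₁.e.symm (MvPowerSeries.X i))) = 0 := by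
  rw [← mem_maximalIdeal_iff_constantCoeff_eq_zero]
  have h1 : (MvPowerSeries.X i : MvPowerSeries (Fin 3) k) ∈ maximalIdeal _ :=
    mem_maximalIdeal_iff_constantCoeff_eq_zero.mpr (MvPowerSeries.constantCoeff_X i)
  have h2 := Ideal.mem_map_of_mem F₁.e.symm h1
  rw [map_ringEquiv_maximalIdeal F₁.e.symm] at h2
  have h3 := Ideal.mem_map_of_mem F₂.e h2
  rwa [map_ringEquiv_maximalIdeal F₂.e] at h3

/-- One frame read in another is a substitution. [OURS · folklore] -/
theorem eq_subst (F₁ F₂ : Frame σ z)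
    (a : AdicCompletion (maximalIdeal (Z.presheaf.stalk z)) (Z.presheaf.stalk z)) :
    F₂.e a = MvPowerSeries.subst (fun i => F₂.e (F₁.e.symm (MvPowerSeries.X i))) (F₁.e a) := by
  refine ringEquiv_map_eq_subst F₁.e F₂.e _ (constantCoeff_change F₁ F₂)
    ((algebraMap _ _).comp (stalkConst σ z)) (fun c => F₁.map_const c)
    (fun i => F₁.e.symm (MvPowerSeries.X i)) (fun i => by simp) (F₁.approx) (RingHom.id _) ?_
    (fun c => F₂.map_const c) (fun i => rfl) a
  rw [Ideal.map_id]

/-- **Change of frame.** Two Cohen frames at the same point differ by a formal coordinate change of the game: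
a substitution without constant terms and with invertible linear part. [OURS · folklore] -/
theorem exists_subst (F₁ F₂ : Frame σ z) :
    ∃ φ : Fin 3 → MvPowerSeries (Fin 3) k, (∀ i, MvPowerSeries.constantCoeff (φ i) = 0) ∧
      IsUnit (FormalCoordChange.linMat φ).det ∧ ∀ a, F₂.e a = MvPowerSeries.subst φ (F₁.e a) := by
  refine ⟨fun i => F₂.e (F₁.e.symm (MvPowerSeries.X i)), constantCoeff_change F₁ F₂, ?_, eq_subst F₁ F₂⟩
  refine isUnit_det_linMat_of_comp_eq_X (φ := fun i => F₁.e (F₂.e.symm (MvPowerSeries.X i)))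
    (constantCoeff_change F₁ F₂) fun s => ?_
  rw [← eq_subst F₁ F₂, RingEquiv.apply_symm_apply]

/-- **Adapted frames.** Every regular system of parameters `y : Fin 3 → 𝒪_{Z,z}` at a framed point is the coordinate
system of a frame (Cohen's structure theorem, `stub_formalChart_cohen`). [OURS · folklore] -/
theorem exists_adapted (F : Frame σ z) (y : Fin 3 → Z.presheaf.stalk z)
    (hy : Ideal.span (Set.range y) = maximalIdeal (Z.presheaf.stalk z)) :
    ∃ F' : Frame σ z, ∀ i, F'.e (algebraMap _ _ (y i)) = MvPowerSeries.X i := by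
  haveI := F.isRegularLocalRing
  obtain ⟨e, he1, he2, -⟩ := stub_formalChart_cohen (Z.presheaf.stalk z) (stalkConst σ z)
    F.residue_surjective y hy F.ringKrullDim_eq
  exact ⟨⟨e, he2⟩, he1⟩

/-- **Won from a monomial frame.** If in SOME frame `F'` an element `T` of the completed local ring reads as a unit
times a monomial, then every divisor of `T` read in ANY frame `F` is won. [OURS · folklore] -/
theorem won_of_dvd_of_eq_unit_mul_monomial (F F' : Frame σ z)
    (T : AdicCompletion (maximalIdeal (Z.presheaf.stalk z)) (Z.presheaf.stalk z))
    (u : MvPowerSeries (Fin 3) k) (hu : MvPowerSeries.constantCoeff u ≠ 0) (a : Fin 3 → ℕ)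
    (hT : F'.e T = u * ∏ i, MvPowerSeries.X i ^ a i) (g : MvPowerSeries (Fin 3) k) (hg : g ∣ F.e T) :
    CobordantGame.Won k 3 g := by
  obtain ⟨φ, hφ0, hφdet, hφ⟩ := exists_subst F F'
  have hs : MvPowerSeries.HasSubst φ := MvPowerSeries.hasSubst_of_constantCoeff_zero hφ0
  have hdvd : MvPowerSeries.subst φ g ∣ u * ∏ i, MvPowerSeries.X i ^ a i := by
    rw [← hT, hφ]
    have := map_dvd (MvPowerSeries.substAlgHom (R := k) hs) hg
    simpa only [MvPowerSeries.substAlgHom_apply] using this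
  exact (won_subst_iff hφ0 hφdet g).mp (won_of_dvd_unit_mul_monomial u hu a _ hdvd)

end Frame

end Summit.ResolutionOfSingularities.ResolutionOfSingularities.Theorems.TrackC

end
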